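import Summits.QuantumFields.BalabanUV.Beta.GAN24.DerivativeRateTransferLoewnerGram

/-!
# `BalabanUV.Beta.GAN24.DerivativeRateTransferSqueeze` — binder row G-an2-4 ∕ (CONV-C), route R6 «VALUES, NOT DERIVATIVES», PART 29:
# THE ROW-DEFECT SQUEEZE — (CONS) REPLACED BY (PROL) + (ROW): the upper comparison of the effective forms from ANY prolongation `P`
# (not averaging-compatible) whose energy defect `PᵀH′P − (1+ε)H − δG ≤ 0` is a form inequality and whose ROW DEFECT
# `r_y := Q′Pℋe_y − e_y` is small in `ℓ²`; the tower END and the entry rate with every slack additive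
# (unit b2b-balaban-gan24-p3, gen 38; v1)

NOT IN PRINT; OUR PROOF (for the ROUTE; [folklore] finite-dimensional linear algebra over an1's bordered letters `kkt ∕ minOp ∕ effForm` BY NAME and
PART 18 ∕ 20's lemmas BY NAME).  HONEST FRAMING (cell contract, verbatim): «discharging `BetaPertH` makes Bałaban's UV stability UNCONDITIONAL — a real
constructive-QFT result; it is NOT the continuum limit and NOT the Clay problem.»  HONEST DEPENDENCY (verbatim): «continuum YM on T⁴ ⇐ BetaPertH ∧ nine
spine estimates (0/9 proved); BetaPertH ⇐ (D1) ∧ (D4) ∧ CAP+tail; G-an2-4 gates asym, D1 and NE2/3/4.»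

WHY THIS FILE.  After PARTs 20–28 route R6's debt line reads «(CONS)(s,t) [the RATE; not in print, [B12] p.264] + S2 + S2(ii) + κ-junction + (BRACKET-c)
+ N + (H2)» (ROUTES-GAN24 v41 §2 R6).  (CONS) as typed in PARTs 15 ∕ 18 ∕ 20 is the ENERGY defect `⟨ℋe_y, (PᵀH′P − H)ℋe_y⟩ ≤ cst·θ^j` of an
AVERAGING-COMPATIBLE prolongation (`Q′P = Q`) of the unit-source minimiser — a statement that needs the discrete `H²`-regularity of `ℋe_y`
(`R6-LOEWNER-NOTE` §2: «this is where the work is»).  THIS FILE removes the compatibility requirement: for ANY prolongation `P` the trial field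
`f := Pℋv − ℋ′r`, `r := Q′Pℋv − v` (the prolongated minimiser corrected by the finer minimiser of its own ROW DEFECT `r`) is admissible one level
up, and the exact expansion of its energy (Euler–Lagrange `H′ℋ′ = Q′ᵀ𝒮′`) gives
  `⟨v,𝒮′v⟩ − ⟨v,𝒮v⟩ ≤ ⟨ℋv,(PᵀH′P − H)ℋv⟩ − 2⟨v,𝒮′r⟩ − ⟨r,𝒮′r⟩`
(gan24-p2 g28's `MonotoneSqueeze.squeeze` in an1's REAL bordered letters, fine forms only PSD).  So the upper comparison costs (PROL) — the energy
defect of the prolongation as a FORM inequality `PᵀH′P ≤ (1+ε)H + δG` (at `U = 1`, `ε = δ = 0`: gan24-p2's `MultilinearProlongation.energy_Pml_le` ∕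
`CochainProlongation.curlEnergy_Pco_le`, hypothesis-free tensor convexity; with a background: holonomy slack, PART 22's currency) — plus (ROW) — the
`ℓ²`-size of the row defect `⟨r_y, r_y⟩ ≤ ϱ_j`, which at FIRST order in `η_j` is a block Cauchy–Schwarz estimate against the ENERGY of `ℋe_y` (no
`H²`-regularity, no decay; companion PART 30) — plus the k-uniform form bound `Λ` of the effective forms ((1.67)-upper class).  Every slack enters the
CONSTANT; the exponent is `ϱ_j^{1∕2}`'s.

WHAT THIS FILE PROVES (0 sorry, 0 `def`, nothing cited; `𝕜 = ℝ`; fine forms PSD, bordered matrices nonsingular):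
* §1 `abs_step_le_of_posSemidef_of_diag` — PART 20's entry bound with the diagonal step as a HYPOTHESIS: `0 ≤ (1+ε)S′ + δM′ − S`, `S′_yy − S_yy ≤ κ`,
  `|S′_ab| ≤ B`, `|M′_ab| ≤ N` ⟹ `|S′_ab − S_ab| ≤ κ + 2εB + 2δN`; `dotProduct_effForm_nonneg`, `posSemidef_effForm`, `abs_effForm_apply_le_of_form_le`
  (the form bound `Λ` bounds the entries).
* §2 **`effForm_step_le_prol_row`** — THE ROW-DEFECT SQUEEZE AT ONE VECTOR (displayed above), and `neg_two_cross_le` (`−2⟨v,𝒮′r⟩ ≤ t⟨v,𝒮′v⟩ + t⁻¹⟨r,𝒮′r⟩`).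
* §3 **`effForm_step_diag_le_of_prolGram`** — (PROL-ε,δ) `PᵀH′P ≤ (1+ε)H + δG` + the form bound `⟨w,𝒮′w⟩ ≤ Λ⟨w,w⟩` ⟹ for every `t > 0` and `y`:
  `(1 − t)·𝒮′_yy ≤ (1+ε)·𝒮_yy + δ·(ℋᵀGℋ)_yy + t⁻¹Λ·⟨r_y, r_y⟩`.
* §4 **`abs_effForm_step_le_of_stabGram_of_prolGram_of_row`** — with PART 20's (STAB-ε′,δ′) comparison on the other side and (ROW) `⟨r_y,r_y⟩ ≤ ϱ`:
  `|𝒮′_ab − 𝒮_ab| ≤ (t + ε + 2ε′)·Λ + (δ + 2δ′)·N + t⁻¹Λ·ϱ`.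
* §5 **`effForm_entry_step_rate_of_stabGram_of_prolGram_of_row`** — THE TOWER END: slacks `cε′θ^j, cδ′θ^j` (STAB), `cεθ^j, cδθ^j` (PROL), row defects
  `⟨r_{j,y}, r_{j,y}⟩ ≤ cϱ·(θ^j)²`, k-uniform `Λ`, `N`, `0 < θ` ⟹ `|𝒮_{j+1}(a,b) − 𝒮_j(a,b)| ≤ ((1 + cε + 2cε′ + cϱ)·Λ + (cδ + 2cδ′)·N)·θ^j` (`t = θ^j`).
WHAT IT DOES NOT DO: prove (PROL) ∕ (ROW) for any operator (PART 30: the row defect of «convex combinations of transported vertex values»; gan24-p2's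
`energy_Pml_le` is (PROL) at `U = 1` for scalars); bound `Λ`, `N`; touch S2 ∕ S2(ii); the capstone join (PART 23's pattern applies verbatim — ON REQUEST).
SUPPLIER work on route R6 (rank 2, REDUCTION, no seat; X-A8 ∕ X-C1 not minted); no consumer of record; NEVER «G-an2-4 closed»; NOT (CONV-C), NOT D1, NOT
`BetaPertH`, NOT continuum, NOT Clay.  Records: `HOME/b2b-balaban-gan24-p3/WOODBURY-FIBRE.md` v13.8, `HOME/beta/ROUTES-GAN24.md` v41 §2 R6.
-/

noncomputable section

open Matrix

namespace Summit.QuantumFields.BalabanUV.Beta.GAN24.DerivativeRateTransferSqueeze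

open Literature.MathematicalPhysics.QuantumFieldTheory.Balaban1983to89.Beta.Composition (kkt)
open Literature.MathematicalPhysics.QuantumFieldTheory.Balaban1983to89.Beta.CompositionSingular (effForm minOp mul_minOp_eq
  minOpL_eq_transpose)
open Summit.QuantumFields.BalabanUV.Beta.GAN24.DerivativeRateTransferLoewnerKKT (abs_apply_le_of_diag_le transpose_eq_of_posSemidef
  mulVec_dotProduct_eq dotProduct_effForm_eq_energy mulVec_minOp dotProduct_effForm_le_trial single_dotProduct_mulVec_single)
open Summit.QuantumFields.BalabanUV.Beta.GAN24.DerivativeRateTransferLoewnerGram (gram_minOp_apply effForm_step_posSemidef_of_stabGram)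

/-! ## §1 Entries from the diagonal; the effective form is PSD and its form bound bounds its entries -/

section Entries

variable {c : Type*} [Fintype c] [DecidableEq c]
variable {S S' M' : Matrix c c ℝ} {ε δ κ B N : ℝ}

omit [Fintype c] [DecidableEq c] in
/-- **ENTRIES FROM A PSD COMPARISON AND A DIAGONAL STEP** (PART 20's `abs_effForm_step_le_of_stabGram_of_cons` with the diagonal step displayed):
`0 ≤ (1+ε)S′ + δM′ − S`, `S′_yy − S_yy ≤ κ`, `|S′_ab| ≤ B`, `|M′_ab| ≤ N`, `0 ≤ ε, δ` ⟹ `|S′_ab − S_ab| ≤ κ + 2εB + 2δN`. [our proof] -/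
theorem abs_step_le_of_posSemidef_of_diag (hD : ((1 + ε) • S' + δ • M' - S).PosSemidef) (hε : 0 ≤ ε) (hδ : 0 ≤ δ)
    (hdiag : ∀ y, S' y y - S y y ≤ κ) (hB : ∀ a b, |S' a b| ≤ B) (hN : ∀ a b, |M' a b| ≤ N) (a b : c) :
    |S' a b - S a b| ≤ κ + 2 * ε * B + 2 * δ * N := by
  have hdiag' : ∀ y, ((1 + ε) • S' + δ • M' - S) y y ≤ κ + ε * B + δ * N := fun y => by
    have hy := (abs_le.mp (hB y y)).2
    have hMy := (abs_le.mp (hN y y)).2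
    rw [Matrix.sub_apply, Matrix.add_apply, Matrix.smul_apply, Matrix.smul_apply, smul_eq_mul, smul_eq_mul]
    nlinarith [hdiag y, mul_le_mul_of_nonneg_left hy hε, mul_le_mul_of_nonneg_left hMy hδ]
  have hDab := abs_apply_le_of_diag_le hD hdiag' a b
  rw [Matrix.sub_apply, Matrix.add_apply, Matrix.smul_apply, Matrix.smul_apply, smul_eq_mul, smul_eq_mul] at hDab
  have hε' : |ε * S' a b| ≤ ε * B := by
    rw [abs_mul, abs_of_nonneg hε]; exact mul_le_mul_of_nonneg_left (hB a b) hε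
  have hδ' : |δ * M' a b| ≤ δ * N := by
    rw [abs_mul, abs_of_nonneg hδ]; exact mul_le_mul_of_nonneg_left (hN a b) hδ
  calc |S' a b - S a b|
      = |((1 + ε) * S' a b + δ * M' a b - S a b) - ε * S' a b - δ * M' a b| := by ring_nf
    _ ≤ |(1 + ε) * S' a b + δ * M' a b - S a b - ε * S' a b| + |δ * M' a b| := abs_sub _ _
    _ ≤ |(1 + ε) * S' a b + δ * M' a b - S a b| + |ε * S' a b| + |δ * M' a b| := add_le_add (abs_sub _ _) le_rfl
    _ ≤ (κ + ε * B + δ * N) + ε * B + δ * N := add_le_add (add_le_add hDab hε') hδ'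
    _ = κ + 2 * ε * B + 2 * δ * N := by ring

variable {ν : Type*} [Fintype ν] [DecidableEq ν] {H : Matrix ν ν ℝ} {Q : Matrix c ν ℝ}

/-- the effective form of a PSD fine form is nonnegative at every vector: `⟨v,𝒮v⟩ = ⟨ℋv, Hℋv⟩ ≥ 0`. [folklore] -/
theorem dotProduct_effForm_nonneg (hH : H.PosSemidef) (h : IsUnit (kkt H Q).det) (v : c → ℝ) :
    0 ≤ v ⬝ᵥ (effForm H Q *ᵥ v) := by
  rw [dotProduct_effForm_eq_energy h v]
  simpa only [star_trivial] using hH.dotProduct_mulVec_nonneg (minOp H Q *ᵥ v)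

/-- the effective form of a PSD fine form is a PSD matrix. [folklore] -/
theorem posSemidef_effForm (hH : H.PosSemidef) (h : IsUnit (kkt H Q).det) : (effForm H Q).PosSemidef := by
  have hS : (effForm H Q)ᵀ = effForm H Q := (minOpL_eq_transpose H Q (transpose_eq_of_posSemidef hH)).2.2
  refine PosSemidef.of_dotProduct_mulVec_nonneg ?_ fun v => ?_
  · rw [Matrix.IsHermitian, Matrix.conjTranspose_eq_transpose_of_trivial, hS]
  · simpa only [star_trivial] using dotProduct_effForm_nonneg hH h v

/-- the symmetry of the effective form at two vectors: `⟨r,𝒮v⟩ = ⟨v,𝒮r⟩`. [folklore] -/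
theorem dotProduct_effForm_comm (hH : H.PosSemidef) (v r : c → ℝ) :
    r ⬝ᵥ (effForm H Q *ᵥ v) = v ⬝ᵥ (effForm H Q *ᵥ r) := by
  have hS : (effForm H Q)ᵀ = effForm H Q := (minOpL_eq_transpose H Q (transpose_eq_of_posSemidef hH)).2.2
  rw [dotProduct_mulVec, ← mulVec_transpose, hS, dotProduct_comm]

/-- **THE FORM BOUND BOUNDS THE ENTRIES**: `⟨w,𝒮w⟩ ≤ Λ⟨w,w⟩` for all `w` ⟹ `|𝒮_ab| ≤ Λ` (diagonal at `e_y`, then the `2 × 2` minor). [folklore] -/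
theorem abs_effForm_apply_le_of_form_le (hH : H.PosSemidef) (h : IsUnit (kkt H Q).det) {Λ : ℝ}
    (hΛ : ∀ w : c → ℝ, w ⬝ᵥ (effForm H Q *ᵥ w) ≤ Λ * (w ⬝ᵥ w)) (a b : c) : |effForm H Q a b| ≤ Λ := by
  refine abs_apply_le_of_diag_le (posSemidef_effForm hH h) (fun y => ?_) a b
  have hy := hΛ (Pi.single y 1)
  rwa [single_dotProduct_mulVec_single, single_dotProduct, one_mul, Pi.single_eq_same, mul_one] at hy

end Entries

/-! ## §2 The row-defect squeeze at one vector -/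

section Squeeze

variable {c ν ν' : Type*} [Fintype c] [Fintype ν] [Fintype ν'] [DecidableEq c] [DecidableEq ν] [DecidableEq ν']
variable {H : Matrix ν ν ℝ} {Q : Matrix c ν ℝ} {H' : Matrix ν' ν' ℝ} {Q' : Matrix c ν' ℝ} {P : Matrix ν' ν ℝ}

/-- Euler–Lagrange at one vector: `⟨w, H′(ℋ′r)⟩ = ⟨Q′w, 𝒮′r⟩` (`H′ℋ′ = Q′ᵀ𝒮′`). [folklore] -/
theorem dotProduct_mulVec_minOp_eq (h' : IsUnit (kkt H' Q').det) (w : ν' → ℝ) (r : c → ℝ) :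
    w ⬝ᵥ (H' *ᵥ (minOp H' Q' *ᵥ r)) = (Q' *ᵥ w) ⬝ᵥ (effForm H' Q' *ᵥ r) := by
  rw [mulVec_mulVec, mul_minOp_eq H' Q' h', ← mulVec_mulVec, ← mulVec_dotProduct_eq]

/-- **`effForm_step_le_prol_row` — THE ROW-DEFECT SQUEEZE AT ONE VECTOR** [our proof; gan24-p2 g28's `MonotoneSqueeze.squeeze` in an1's real bordered
letters]: fine forms with `H′` PSD, bordered matrices nonsingular, ANY `P : ν′ × ν`; with `ℋ = minOp H Q`, `r := Q′Pℋv − v` (the ROW DEFECT):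
`⟨v,𝒮′v⟩ − ⟨v,𝒮v⟩ ≤ ⟨ℋv,(PᵀH′P − H)ℋv⟩ − 2⟨v,𝒮′r⟩ − ⟨r,𝒮′r⟩`.  Proof: the trial field `Pℋv − ℋ′r` has `Q′`-rows exactly `v`; expand its
`H′`-energy with Euler–Lagrange `⟨Pℋv, H′ℋ′r⟩ = ⟨v + r, 𝒮′r⟩` and `⟨ℋ′r,H′ℋ′r⟩ = ⟨r,𝒮′r⟩`. -/
theorem effForm_step_le_prol_row (hH' : H'.PosSemidef) (h : IsUnit (kkt H Q).det) (h' : IsUnit (kkt H' Q').det) (v : c → ℝ) :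
    v ⬝ᵥ (effForm H' Q' *ᵥ v) - v ⬝ᵥ (effForm H Q *ᵥ v) ≤
      (minOp H Q *ᵥ v) ⬝ᵥ ((Pᵀ * H' * P - H) *ᵥ (minOp H Q *ᵥ v))
        - 2 * (v ⬝ᵥ (effForm H' Q' *ᵥ (Q' *ᵥ (P *ᵥ (minOp H Q *ᵥ v)) - v)))
        - (Q' *ᵥ (P *ᵥ (minOp H Q *ᵥ v)) - v) ⬝ᵥ (effForm H' Q' *ᵥ (Q' *ᵥ (P *ᵥ (minOp H Q *ᵥ v)) - v)) := by
  set m : ν → ℝ := minOp H Q *ᵥ v with hm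
  set r : c → ℝ := Q' *ᵥ (P *ᵥ m) - v with hr
  set g : ν' → ℝ := minOp H' Q' *ᵥ r with hg
  have hHt : H'ᵀ = H' := transpose_eq_of_posSemidef hH'
  -- the trial field `Pm − g` is admissible one level up
  have hadm : Q' *ᵥ (P *ᵥ m - g) = v := by
    rw [mulVec_sub, hg, mulVec_minOp h', hr, sub_sub_cancel]
  have h1 := dotProduct_effForm_le_trial hH' h' hadm
  -- the four terms of the trial energy
  have hPm : (P *ᵥ m) ⬝ᵥ (H' *ᵥ (P *ᵥ m)) = m ⬝ᵥ ((Pᵀ * H' * P) *ᵥ m) := by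
    rw [mulVec_dotProduct_eq, mulVec_mulVec, mulVec_mulVec, Matrix.mul_assoc]
  have hcross : (P *ᵥ m) ⬝ᵥ (H' *ᵥ g) = v ⬝ᵥ (effForm H' Q' *ᵥ r) + r ⬝ᵥ (effForm H' Q' *ᵥ r) := by
    rw [hg, dotProduct_mulVec_minOp_eq h', ← add_dotProduct]
    congr 1
    rw [hr, add_sub_cancel]
  have hcross' : g ⬝ᵥ (H' *ᵥ (P *ᵥ m)) = (P *ᵥ m) ⬝ᵥ (H' *ᵥ g) := by
    rw [dotProduct_mulVec, ← mulVec_transpose, hHt, dotProduct_comm]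
  have hgg : g ⬝ᵥ (H' *ᵥ g) = r ⬝ᵥ (effForm H' Q' *ᵥ r) := by rw [hg, ← dotProduct_effForm_eq_energy h' r]
  have hexp : (P *ᵥ m - g) ⬝ᵥ (H' *ᵥ (P *ᵥ m - g)) =
      m ⬝ᵥ ((Pᵀ * H' * P) *ᵥ m) - 2 * (v ⬝ᵥ (effForm H' Q' *ᵥ r)) - r ⬝ᵥ (effForm H' Q' *ᵥ r) := by
    rw [mulVec_sub, sub_dotProduct, dotProduct_sub, dotProduct_sub, hPm, hcross', hcross, hgg]
    ring
  have hSv : v ⬝ᵥ (effForm H Q *ᵥ v) = m ⬝ᵥ (H *ᵥ m) := by rw [hm, dotProduct_effForm_eq_energy h v]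
  rw [hexp] at h1
  rw [hSv, sub_mulVec, dotProduct_sub]
  linarith

/-- **`neg_two_cross_le`** — the cross term against a PSD form: `−2⟨v,𝒮′r⟩ ≤ t⟨v,𝒮′v⟩ + t⁻¹⟨r,𝒮′r⟩` for every `t > 0`
(`0 ≤ ⟨v + t⁻¹r, 𝒮′(v + t⁻¹r)⟩`, no square root). [folklore] -/
theorem neg_two_cross_le (hH' : H'.PosSemidef) (h' : IsUnit (kkt H' Q').det) (v r : c → ℝ) {t : ℝ} (ht : 0 < t) :
    -2 * (v ⬝ᵥ (effForm H' Q' *ᵥ r)) ≤ t * (v ⬝ᵥ (effForm H' Q' *ᵥ v)) + t⁻¹ * (r ⬝ᵥ (effForm H' Q' *ᵥ r)) := by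
  have ht' : t ≠ 0 := ht.ne'
  have h0 := dotProduct_effForm_nonneg hH' h' (v + t⁻¹ • r)
  have hsym : r ⬝ᵥ (effForm H' Q' *ᵥ v) = v ⬝ᵥ (effForm H' Q' *ᵥ r) := dotProduct_effForm_comm hH' v r
  have hexp : (v + t⁻¹ • r) ⬝ᵥ (effForm H' Q' *ᵥ (v + t⁻¹ • r)) =
      v ⬝ᵥ (effForm H' Q' *ᵥ v) + 2 * t⁻¹ * (v ⬝ᵥ (effForm H' Q' *ᵥ r)) + t⁻¹ * t⁻¹ * (r ⬝ᵥ (effForm H' Q' *ᵥ r)) := by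
    rw [mulVec_add, mulVec_smul, add_dotProduct, dotProduct_add, dotProduct_add, smul_dotProduct, smul_dotProduct, dotProduct_smul,
      dotProduct_smul, hsym]
    simp only [smul_eq_mul]
    ring
  have e : t * ((v + t⁻¹ • r) ⬝ᵥ (effForm H' Q' *ᵥ (v + t⁻¹ • r))) =
      t * (v ⬝ᵥ (effForm H' Q' *ᵥ v)) + 2 * (v ⬝ᵥ (effForm H' Q' *ᵥ r)) + t⁻¹ * (r ⬝ᵥ (effForm H' Q' *ᵥ r)) := by
    rw [hexp]
    field_simp
  have h2 : 0 ≤ t * (v ⬝ᵥ (effForm H' Q' *ᵥ v)) + 2 * (v ⬝ᵥ (effForm H' Q' *ᵥ r)) + t⁻¹ * (r ⬝ᵥ (effForm H' Q' *ᵥ r)) := by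
    rw [← e]; exact mul_nonneg ht.le h0
  linarith

end Squeeze

/-! ## §3 Two levels under (PROL-ε,δ): the diagonal step up to the row defect -/

section TwoLevels

variable {c ν ν' : Type*} [Fintype c] [Fintype ν] [Fintype ν'] [DecidableEq c] [DecidableEq ν] [DecidableEq ν']
variable {H : Matrix ν ν ℝ} {Q : Matrix c ν ℝ} {H' : Matrix ν' ν' ℝ} {Q' : Matrix c ν' ℝ} {Qf : Matrix ν ν' ℝ} {P : Matrix ν' ν ℝ}
variable {G : Matrix ν ν ℝ} {G' : Matrix ν' ν' ℝ} {ε δ ε' δ' Λ : ℝ}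

/-- **`effForm_step_diag_le_of_prolGram` — (PROL-ε,δ) BOUNDS THE DIAGONAL STEP UP TO THE ROW DEFECT** [our proof]: `H′` PSD, bordered matrices
nonsingular, (PROL-ε,δ) `PᵀH′P ≤ (1+ε)H + δG` and the form bound `⟨w,𝒮′w⟩ ≤ Λ⟨w,w⟩` ⟹ for every `t > 0` and every `y`, with
`r_y := Q′Pℋe_y − e_y`:  `(1 − t)·𝒮′_yy ≤ (1+ε)·𝒮_yy + δ·(ℋᵀGℋ)_yy + t⁻¹·Λ·⟨r_y, r_y⟩`. -/
theorem effForm_step_diag_le_of_prolGram (hH' : H'.PosSemidef) (h : IsUnit (kkt H Q).det)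
    (h' : IsUnit (kkt H' Q').det) (hprol : ((1 + ε) • H + δ • G - Pᵀ * H' * P).PosSemidef)
    (hΛ : ∀ w : c → ℝ, w ⬝ᵥ (effForm H' Q' *ᵥ w) ≤ Λ * (w ⬝ᵥ w)) {t : ℝ} (ht : 0 < t) (y : c) :
    (1 - t) * effForm H' Q' y y ≤ (1 + ε) * effForm H Q y y + δ * ((minOp H Q)ᵀ * G * minOp H Q) y y
      + t⁻¹ * Λ * ((Q' *ᵥ (P *ᵥ (minOp H Q *ᵥ Pi.single y 1)) - Pi.single y 1) ⬝ᵥ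
          (Q' *ᵥ (P *ᵥ (minOp H Q *ᵥ Pi.single y 1)) - Pi.single y 1)) := by
  set v : c → ℝ := Pi.single y 1 with hv
  set m : ν → ℝ := minOp H Q *ᵥ v with hm
  set r : c → ℝ := Q' *ᵥ (P *ᵥ m) - v with hr
  have hsq := effForm_step_le_prol_row (P := P) hH' h h' v
  rw [← hm, ← hr, sub_mulVec, dotProduct_sub] at hsq
  have hpr := hprol.dotProduct_mulVec_nonneg m
  simp only [star_trivial, sub_mulVec, add_mulVec, smul_mulVec, dotProduct_sub, dotProduct_add, dotProduct_smul, smul_eq_mul,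
    sub_nonneg] at hpr
  have hcr := neg_two_cross_le hH' h' v r ht
  have hrr0 : 0 ≤ r ⬝ᵥ (effForm H' Q' *ᵥ r) := dotProduct_effForm_nonneg hH' h' r
  have hmul : t⁻¹ * (r ⬝ᵥ (effForm H' Q' *ᵥ r)) ≤ t⁻¹ * (Λ * (r ⬝ᵥ r)) :=
    mul_le_mul_of_nonneg_left (hΛ r) (inv_pos.mpr ht).le
  have e1 : effForm H' Q' y y = v ⬝ᵥ (effForm H' Q' *ᵥ v) := (single_dotProduct_mulVec_single _ y).symm
  have e2 : effForm H Q y y = v ⬝ᵥ (effForm H Q *ᵥ v) := (single_dotProduct_mulVec_single _ y).symm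
  have e3 : ((minOp H Q)ᵀ * G * minOp H Q) y y = m ⬝ᵥ (G *ᵥ m) := by rw [gram_minOp_apply, ← hv, ← hm]
  have e4 : v ⬝ᵥ (effForm H Q *ᵥ v) = m ⬝ᵥ (H *ᵥ m) := by rw [hm, dotProduct_effForm_eq_energy h v]
  rw [e1, e2, e3, e4]
  rw [e4] at hsq
  have hassoc : t⁻¹ * Λ * (r ⬝ᵥ r) = t⁻¹ * (Λ * (r ⬝ᵥ r)) := by ring
  rw [hassoc]
  linarith [hsq, hpr, hcr, hrr0, hmul]

/-- **`abs_effForm_step_le_of_stabGram_of_prolGram_of_row` — THE TWO-LEVEL ENTRY BOUND** [our proof]: `Q′ = Q·Qf`, symmetric mass forms `G` (level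
`ν`) and `G′` (level `ν′`); (STAB-ε′,δ′) `Qfᵀ H Qf ≤ (1+ε′)H′ + δ′G′` (PART 20's side), (PROL-ε,δ) `PᵀH′P ≤ (1+ε)H + δG`, (ROW) `⟨r_y,r_y⟩ ≤ ϱ`, the
k-uniform form bound `Λ` on BOTH effective forms and Gram bounds `|(ℋᵀGℋ)_ab|, |(ℋ′ᵀG′ℋ′)_ab| ≤ N`, `0 ≤ ε, δ, ε′, δ′`, `0 < t` ⟹
`|𝒮′_ab − 𝒮_ab| ≤ (t + ε + 2ε′)·Λ + (δ + 2δ′)·N + t⁻¹·Λ·ϱ`. -/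
theorem abs_effForm_step_le_of_stabGram_of_prolGram_of_row (hH : H.PosSemidef) (hH' : H'.PosSemidef) (h : IsUnit (kkt H Q).det)
    (h' : IsUnit (kkt H' Q').det) (hcomp : Q' = Q * Qf) (hG' : G'ᵀ = G') {ϱ N : ℝ} {t : ℝ} (ht : 0 < t)
    (hε : 0 ≤ ε) (hδ : 0 ≤ δ) (hε' : 0 ≤ ε') (hδ' : 0 ≤ δ')
    (hstab : ((1 + ε') • H' + δ' • G' - Qfᵀ * H * Qf).PosSemidef) (hprol : ((1 + ε) • H + δ • G - Pᵀ * H' * P).PosSemidef)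
    (hrow : ∀ y, (Q' *ᵥ (P *ᵥ (minOp H Q *ᵥ Pi.single y 1)) - Pi.single y 1) ⬝ᵥ
        (Q' *ᵥ (P *ᵥ (minOp H Q *ᵥ Pi.single y 1)) - Pi.single y 1) ≤ ϱ)
    (hΛ : ∀ w : c → ℝ, w ⬝ᵥ (effForm H Q *ᵥ w) ≤ Λ * (w ⬝ᵥ w)) (hΛ' : ∀ w : c → ℝ, w ⬝ᵥ (effForm H' Q' *ᵥ w) ≤ Λ * (w ⬝ᵥ w))
    (hN : ∀ a b, |((minOp H Q)ᵀ * G * minOp H Q) a b| ≤ N) (hN' : ∀ a b, |((minOp H' Q')ᵀ * G' * minOp H' Q') a b| ≤ N)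
    (a b : c) :
    |effForm H' Q' a b - effForm H Q a b| ≤ (t + ε + 2 * ε') * Λ + (δ + 2 * δ') * N + t⁻¹ * Λ * ϱ := by
  have hD := effForm_step_posSemidef_of_stabGram hH hH' h h' hcomp hG' hstab
  have hBS : ∀ a b, |effForm H Q a b| ≤ Λ := abs_effForm_apply_le_of_form_le hH h hΛ
  have hBS' : ∀ a b, |effForm H' Q' a b| ≤ Λ := abs_effForm_apply_le_of_form_le hH' h' hΛ'
  have hΛ0 : 0 ≤ Λ := (abs_nonneg _).trans (hBS a b)
  have ht' : 0 ≤ t⁻¹ * Λ := mul_nonneg (inv_pos.mpr ht).le hΛ0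
  -- the diagonal step
  have hdiag : ∀ y, effForm H' Q' y y - effForm H Q y y ≤ (t + ε) * Λ + δ * N + t⁻¹ * Λ * ϱ := fun y => by
    have hd := effForm_step_diag_le_of_prolGram hH' h h' hprol hΛ' ht y
    have hy := (abs_le.mp (hBS y y)).2
    have hy' := (abs_le.mp (hBS' y y)).2
    have hNy := (abs_le.mp (hN y y)).2
    nlinarith [hrow y, mul_le_mul_of_nonneg_left hy hε, mul_le_mul_of_nonneg_left hy' ht.le, mul_le_mul_of_nonneg_left hNy hδ,
      mul_le_mul_of_nonneg_left (hrow y) ht']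
  have h := abs_step_le_of_posSemidef_of_diag hD hε' hδ' hdiag hBS' hN' a b
  refine h.trans (le_of_eq ?_)
  ring

end TwoLevels

/-! ## §4 The tower END: (STAB-ε′_j,δ′_j) + (PROL-ε_j,δ_j) + (ROW_j) with geometric slacks -/

section Tower

variable {c : Type*} [Fintype c] [DecidableEq c]
variable {ι : ℕ → Type*} [∀ j, Fintype (ι j)] [∀ j, DecidableEq (ι j)]
variable {H : ∀ j, Matrix (ι j) (ι j) ℝ} {Qf : ∀ j, Matrix (ι j) (ι (j + 1)) ℝ} {Qc : ∀ j, Matrix c (ι j) ℝ}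
variable {P : ∀ j, Matrix (ι (j + 1)) (ι j) ℝ} {G : ∀ j, Matrix (ι j) (ι j) ℝ} {cε cδ cε' cδ' cϱ θ Λ N : ℝ}

/-- **`effForm_entry_step_rate_of_stabGram_of_prolGram_of_row` — THE TOWER END OF THE ROW-DEFECT SQUEEZE** [our proof]: PSD fine forms `H j`, nonsingular
bordered matrices, `Qc (j+1) = Qc j · Qf j`, symmetric mass forms `G j`; (STAB-ε′_j,δ′_j) `(Qf j)ᵀ H_j (Qf j) ≤ (1 + cε′·θ^j)·H_{j+1} + (cδ′·θ^j)·G_{j+1}`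
(PART 22 ∕ 23's output), (PROL-ε_j,δ_j) `(P j)ᵀ H_{j+1} (P j) ≤ (1 + cε·θ^j)·H_j + (cδ·θ^j)·G_j` (ANY prolongation), (ROW_j)
`⟨r_{j,y}, r_{j,y}⟩ ≤ cϱ·(θ^j)²` for the row defects `r_{j,y} := Qc_{j+1}·P_j·ℋ_j e_y − e_y`, the k-uniform form bound `⟨w,𝒮_jw⟩ ≤ Λ⟨w,w⟩` and Gram bound
`|(ℋ_jᵀ G_j ℋ_j)_{ab}| ≤ N` (`0 ≤ cε, cδ, cε′, cδ′`, `0 < θ`) ⟹ for all `j, a, b`: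
`|𝒮_{j+1}(a,b) − 𝒮_j(a,b)| ≤ ((1 + cε + 2cε′ + cϱ)·Λ + (cδ + 2cδ′)·N)·θ^j` — NO averaging-compatibility of `P`, NO (CONS); the choice `t = θ^j`. -/
theorem effForm_entry_step_rate_of_stabGram_of_prolGram_of_row (hH : ∀ j, (H j).PosSemidef) (hk : ∀ j, IsUnit (kkt (H j) (Qc j)).det)
    (hcomp : ∀ j, Qc (j + 1) = Qc j * Qf j) (hG : ∀ j, (G j)ᵀ = G j)
    (hcε : 0 ≤ cε) (hcδ : 0 ≤ cδ) (hcε' : 0 ≤ cε') (hcδ' : 0 ≤ cδ') (hθ0 : 0 < θ)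
    (hstab : ∀ j, ((1 + cε' * θ ^ j) • H (j + 1) + (cδ' * θ ^ j) • G (j + 1) - (Qf j)ᵀ * H j * Qf j).PosSemidef)
    (hprol : ∀ j, ((1 + cε * θ ^ j) • H j + (cδ * θ ^ j) • G j - (P j)ᵀ * H (j + 1) * P j).PosSemidef)
    (hrow : ∀ j (y : c), (Qc (j + 1) *ᵥ (P j *ᵥ (minOp (H j) (Qc j) *ᵥ Pi.single y 1)) - Pi.single y 1) ⬝ᵥ
        (Qc (j + 1) *ᵥ (P j *ᵥ (minOp (H j) (Qc j) *ᵥ Pi.single y 1)) - Pi.single y 1) ≤ cϱ * (θ ^ j) ^ 2)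
    (hΛ : ∀ j (w : c → ℝ), w ⬝ᵥ (effForm (H j) (Qc j) *ᵥ w) ≤ Λ * (w ⬝ᵥ w))
    (hN : ∀ j a b, |((minOp (H j) (Qc j))ᵀ * G j * minOp (H j) (Qc j)) a b| ≤ N) :
    ∀ j (a b : c), |effForm (H (j + 1)) (Qc (j + 1)) a b - effForm (H j) (Qc j) a b| ≤
      ((1 + cε + 2 * cε' + cϱ) * Λ + (cδ + 2 * cδ') * N) * θ ^ j := by
  intro j a b
  have hθj : 0 < θ ^ j := pow_pos hθ0 j
  have h := abs_effForm_step_le_of_stabGram_of_prolGram_of_row (hH j) (hH (j + 1)) (hk j) (hk (j + 1)) (hcomp j) (hG (j + 1))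
    hθj (mul_nonneg hcε hθj.le) (mul_nonneg hcδ hθj.le) (mul_nonneg hcε' hθj.le) (mul_nonneg hcδ' hθj.le) (hstab j) (hprol j) (hrow j)
    (hΛ j) (hΛ (j + 1)) (fun a b => hN j a b) (fun a b => hN (j + 1) a b) a b
  refine h.trans (le_of_eq ?_)
  have hθj' : (θ ^ j)⁻¹ * Λ * (cϱ * (θ ^ j) ^ 2) = cϱ * Λ * θ ^ j := by
    field_simp
  rw [hθj']
  ring

end Tower

end Summit.QuantumFields.BalabanUV.Beta.GAN24.DerivativeRateTransferSqueeze

end
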